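/-
Copyright: b2b-lace packet (Lean typing seat 1, gen 41).  [FvdH17] §5.1 "Elements of the bounds" / §5.4 / §4.2
(4.17)–(4.18) and [NoBLE17] §5.3.2 (5.41): the ENTRY INEQUALITIES for the elements `(P⃗^E)_2` and `(P⃗^S)_2`
(the closed repulsive triangle `𝓣_{1,2,1}(x,y,0)` and the double connection `𝓓_{2,2}(x)`) in terms of the Triangle and
Bubble cells with printed constants, over the tree objects `vecPE`/`vecPS` (`NobleBlocks`), `Letters.perc`
(`NoblePercLetters`), `repTriangle` (`RepulsiveTriangleExtractionIndep`), the remainder slots of `RepulsivePolygonSlots` /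
`NbwRemainderFramePrinted`, and the landed Bubble cell (`NobleEntryVecPEZero.halfBubblePrintedR`).  Proofs only; no named
fact; no numeral; no dimension.
-/
import Literature.Probability.FitznerVanDerHofstad2017.NobleEntryVecPEZero
import Literature.Probability.FitznerVanDerHofstad2017.NoblePercLettersDict
import Literature.Probability.FitznerVanDerHofstad2017.NbwRemainderFramePrinted
import HarnessLib

/-!
# [FvdH17] §5.1 / §5.4: the entries `(P⃗^E)_2 = Σ_{x,y≠0} 𝓣_{1,2,1}(x,y,0) ≤ Bound[Triangle, 4, M]` and
`(P⃗^S)_2 = Σ_{x≠0} [𝓓_{2,2}(x) + Σ_{y≠0} 𝓣_{1,2,1}(x,y,0)] ≤ ½·Bound[Bubble, 2, M] + Bound[Triangle, 4, M]`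

CITATION HEADER (PLACEMENT v2). This module is part of a certified REPRODUCTION of:
R. Fitzner, R. van der Hofstad, *Mean-field behavior for nearest-neighbor percolation in `d > 10`*,
Electron. J. Probab. **22** (2017) no. 43 [FvdH17] (extended version arXiv:1506.07977v2), §5.1 "Elements of the
bounds" (arXiv v2 p. 49: `(P⃗^S)_b = Σ_{x,y} P^{S,b}(x,y)`, `(P⃗^E)_b = Σ_{x,y} P^{E,b}(x,y)`), App. B Table
"definition of `P^b(x,y)`" row `b = 2` (p. 73), §5.4 "Summary of the bounds" (closing paragraph, p. 56; EJP p. 52: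
"… we can compute numerical bounds on these diagrammatic bounds, see (4.21) for the idea of these bounds, or
[NoBLE, Section 5] for a complete description"), §4.2 (4.17)–(4.18) and the display after (4.18) (p. 36: the repulsive
diagrams are bounded "using (4.18)" by simple diagrams with closed-trail counts and simple-random-walk tails) and
(4.12) (p. 35: `𝓓_{j₁,j₂}` decreasing in its indices); of
R. Fitzner, R. van der Hofstad, *Generalized approach to the non-backtracking lace expansion*, Probab. Theory Related
Fields **169** (2017) 1041–1119 [NoBLE17], §5.3.2 (5.41) (p. 1098: the triangle with one-, two- and three-G tails) and
the first display of §5.3.2 (p. 1097: each tail `(2d)^M K_{n,M}`), §5.3.1 and (5.13) (pp. 1091, 1096–1097: the printed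
constants `(2dp)^M ≤ ((2d/(2d−1))Γ₁)^M`, `Γ̄₂ ≤ ((2d−2)/(2d−1))Γ₂`); and of the authors' notebook `Percolation.nb`
(www.fitzner.nl/noble/), cells 11 (`Bound[Triangle,m,s]`) and 16 (`Bound[PE,2,s] = Bound[Triangle,4,s]`,
`Bound[PS,2,s] = Bound[Triangle,4,s] + ½·Bound[Bubble,2,s]`; typed as `Stage1Cells.PE P 2` / `Stage1Cells.PS P 2`).
Origin: build `lace` (host summit CriticalPhenomena), Lean typing seat; node N76-E(a) of the cell's lemma DAG (the plain
`N = 1` entry inequalities), entry `(V).2` (companion of `NobleEntryVecPEZero`, entry `(V).0`).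

WHAT THIS FILE DOES.  The closed forms `vecPE_two : vecPE L 2 = Σ_x Σ_y (1−δ_{x,0})(1−δ_{y,0}) 𝓣^L_{1,2,1}(x,y,0)` and
`vecPS_two : vecPS L 2 = Σ_x (1−δ_{x,0}) [𝓓^L_{2,2}(x) + Σ_y (1−δ_{y,0}) 𝓣^L_{1,2,1}(x,y,0)]` (`NobleElementsClosedForms`)
are identities for every letter table `L`; all indices are AT-LEAST indices, so at `L = Letters.perc d p` the letters
are `ofReal (repTriangle d p 1 2 1 x y 0)` (`perc_T_ge`) and `diagDT d p 2 2 x` (`perc_D_ge`).  The landed slot theorem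
`sum_sum_repTriangle_le_slots` ([NoBLE17] (5.41) at abstract remainder-kernel constants, closed-trail extraction
(4.17)–(4.18) discharged) at the apex `x = 0`, endpoint set `univ`, with the landed PRINTED kernel constants
`isRemKernelConst_srwK_univ` (`R_n = (2d)^M K_{n,M}(0)` for the compositions `[M]`, `[M−1,1]`, `[M−3,2,1]`; the
three-piece constant needs `2·3+1 ≤ d`), followed by the printed-constant dominations `two_d_mul_le_of_le` /
`nobleSup2_le_of_nobleF2_le`, gives the ENTRY INEQUALITIES in the shape the block-summation majorant consumes
(`BlockSummationMajorant.tsum_toReal_le_of_xSpaceBound_of_majorants`, hypotheses `hPS`/`hPE : ∀ b, vecP … b ≤ ENNReal.ofReal (… b)`):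

* `tsum_tsum_le_of_finset_rect` — a double `tsum` in `ℝ≥0∞` is bounded by a bound of all its finite rectangles;
* `trianglePrintedR d p Γ₁ Γ₂ m M` — the right-hand side of the Triangle cell as a TOTAL real function (finite sum over
  `L ∈ [m, M)` of `C(L+2−m, 2)·#{closed L-trails at 0}·p^L`, plus the three SRW-integral tails
  `C(M+1−m, 2)·((2d/(2d−1))Γ₁)^M·((2d−2)/(2d−1))Γ₂·K_{1,M}(0)`, `(M−m)·((2d/(2d−1))Γ₁)^M·(((2d−2)/(2d−1))Γ₂)²·K_{2,M}(0)`,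
  `((2d/(2d−1))Γ₁)^M·(((2d−2)/(2d−1))Γ₂)³·K_{3,M}(0)`; the multiplicities are those of the landed slot theorem — one-tail
  `C(M+1−m,2)`, two-tail `(M−m)` — i.e. the first printed form of (5.41));
* `sum_sum_repTriangle_zero_le_trianglePrintedR` — `Σ_{v∈S₁} Σ_{y∈S₂} repTriangle d p m₁ m₂ m₃ v y 0 ≤ trianglePrintedR d p Γ₁ Γ₂ (m₁+m₂+m₃) M`
  for all finite `S₁, S₂` (`7 ≤ d`, `p < p_c`, `m₂ + m₃ ≤ M`, `(2d−1)p ≤ Γ₁`, `nobleF2 d p ≤ Γ₂`), `trianglePrintedR_nonneg`,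
  and `tsum_tsum_perc_T_zero_le_ofReal` — `Σ_v Σ_y 𝓣_{m₁,m₂,m₃}(v,y,0) ≤ ofReal (trianglePrintedR …)` for the instance's letter;
* `vecPE_two_le_tsum` / `vecPS_two_le_add` — for ANY letter table: `(P⃗^E)_2 ≤ Σ_x Σ_y 𝓣_{1,2,1}(x,y,0)`,
  `(P⃗^S)_2 ≤ Σ_x 𝓓_{2,2}(x) + Σ_x Σ_y 𝓣_{1,2,1}(x,y,0)` (the factors `(1−δ)` dropped);
* `vecPETwoR d p Γ₁ Γ₂ M := trianglePrintedR d p Γ₁ Γ₂ 4 M` and **the entry inequality** `vecPE_two_le_ofReal :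
  vecPE (Letters.perc d p) 2 ≤ ENNReal.ofReal (vecPETwoR d p Γ₁ Γ₂ M)` (`7 ≤ d`, `p < p_c`, `(2d−1)p ≤ Γ₁`, `nobleF2 d p ≤ Γ₂`,
  `3 ≤ M`), with `vecPETwoR_nonneg`;
* `vecPSTwoR d p Γ₁ Γ₂ M := halfBubblePrintedR d p Γ₁ Γ₂ 1 M + trianglePrintedR d p Γ₁ Γ₂ 4 M` (the notebook's composition
  `Bound[Triangle,4,s] + ½·Bound[Bubble,2,s]`: `𝓓_{2,2} ≤ 𝓓_{1,1}` pointwise by (4.12), `diagDT_anti`, then the Bubble cell at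
  `n = 1`) and **the entry inequality** `vecPS_two_le_ofReal : vecPS (Letters.perc d p) 2 ≤ ENNReal.ofReal (vecPSTwoR d p Γ₁ Γ₂ M)`
  (same hypotheses), with `vecPSTwoR_nonneg`; and the sharper variant through the Bubble cell at `n = 2`,
  `vecPS_two_le_ofReal_sharp : vecPS (Letters.perc d p) 2 ≤ ENNReal.ofReal (halfBubblePrintedR d p Γ₁ Γ₂ 2 M + trianglePrintedR d p Γ₁ Γ₂ 4 M)`
  (`4 ≤ M`);
* `matA_zero_two_le_tsum` / `perc_matA_zero_two_le_ofReal` — the matrix entry `(A)_{0,2}` (`matA_zero_two`, the same closed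
  repulsive triangle): `matA (Letters.perc d p) 0 2 ≤ ENNReal.ofReal (trianglePrintedR d p Γ₁ Γ₂ 4 M)` (notebook cell 18
  `Bound[A,0,2,s] = Bound[Triangle,4,s]`, `Stage1Cells.A P 0 2`).

Any `d ≥ 7`; nothing landed is modified; no cited hypothesis — every statement is a kernel-proved inequality between
the landed definitions.  The identification of `trianglePrintedR` / `halfBubblePrintedR` with the notebook's table
expressions (closed-trail counts `nrBAW[j,d,{0}]`, SRW integrals `I[n,R,{0}]`, `z[o] = Γ₁/(2d−1)`, `VarGamma2`; the
notebook's one-tail multiplicity in cell 11 is `(R−m)(R−1−m)/2`, the typed one is the printed `C(M+1−m,2)` of the landed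
slot theorem — packet register DIVERGENCE D57) and every numerical reading are NOT part of this module.
-/

noncomputable section

namespace Literature.Probability.FitznerVanDerHofstad2017

open MeasureTheory Finset
open scoped BigOperators ENNReal
open Literature.Probability.LatticeModels Literature.Probability.Percolation
open Literature.Barriers.CriticalPhenomena
open Literature.Probability.FitznerVanDerHofstad2017.NobleBlocks

variable {d : ℕ}

/-! ## A. A double `tsum` in `ℝ≥0∞` is bounded through its finite rectangles -/

/-- If every finite rectangle sum of `f : α → β → ℝ≥0∞` is at most `c`, then `Σ_a Σ_b f a b ≤ c`
(a finite set of pairs lies in the product of its two projections; private plumbing for §C). [folklore] -/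
private theorem tsum_tsum_le_of_finset_rect {α β : Type*} {f : α → β → ℝ≥0∞} {c : ℝ≥0∞}
    (h : ∀ (S₁ : Finset α) (S₂ : Finset β), ∑ a ∈ S₁, ∑ b ∈ S₂, f a b ≤ c) :
    ∑' a, ∑' b, f a b ≤ c := by
  classical
  rw [← ENNReal.tsum_prod, ENNReal.tsum_eq_iSup_sum]
  refine iSup_le fun s => ?_
  calc ∑ q ∈ s, f q.1 q.2 ≤ ∑ q ∈ s.image Prod.fst ×ˢ s.image Prod.snd, f q.1 q.2 :=
        Finset.sum_le_sum_of_subset_of_nonneg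
          (fun q hq => Finset.mem_product.2 ⟨Finset.mem_image_of_mem _ hq, Finset.mem_image_of_mem _ hq⟩)
          (fun _ _ _ => zero_le)
    _ = ∑ a ∈ s.image Prod.fst, ∑ b ∈ s.image Prod.snd, f a b := Finset.sum_product _ _ _
    _ ≤ c := h _ _

/-! ## B. The Triangle cell with printed constants as a total real function -/

/-- `Bound[Triangle, m, M]`-shape with the printed constants: the right-hand side of the landed slot theorem
`sum_sum_repTriangle_le_slots` ([NoBLE17] (5.41), first printed form) at the apex `x = 0` with each tail
`p^M Γ̄₂ⁿ (2d)^M K_{n,M}(0)` dominated by `((2d/(2d−1))Γ₁)^M (((2d−2)/(2d−1))Γ₂)ⁿ K_{n,M}(0)`, as a total real function of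
`(d, p, Γ₁, Γ₂, m, M)`. [cite: FitznerVanDerHofstad2016NoBLE, §5.3.2 (5.41) p. 1098, first display p. 1097; §5.3.1 and (5.13) pp. 1091, 1096–1097]
[cite: FitznerVanDerHofstad2017, §4.2 (4.17)–(4.18) (arXiv:1506.07977v2 p. 36); notebook Percolation.nb cell 11] -/
def trianglePrintedR (d : ℕ) (p Γ₁ Γ₂ : ℝ) (m M : ℕ) : ℝ :=
  (∑ L ∈ Finset.Ico m M, (((L + 2 - m).choose 2 : ℕ) : ℝ) * ((trailWordsTo d L 0).card : ℝ) * p ^ L) +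
    (((M + 1 - m).choose 2 : ℕ) : ℝ) *
        ((2 * d / (2 * d - 1) * Γ₁) ^ M * ((2 * d - 2) / (2 * d - 1) * Γ₂ * srwK d 1 M 0)) +
      ((M - m : ℕ) : ℝ) * ((2 * d / (2 * d - 1) * Γ₁) ^ M * (((2 * d - 2) / (2 * d - 1) * Γ₂) ^ 2 * srwK d 2 M 0)) +
        (2 * d / (2 * d - 1) * Γ₁) ^ M * (((2 * d - 2) / (2 * d - 1) * Γ₂) ^ 3 * srwK d 3 M 0)

/-- The landed printed kernel constant `(2d)^M K_{n,M}(0)` (`isRemKernelConst_srwK_univ`) for a composition `c` of `M`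
into `n` pieces, with `c.length`/`c.sum` replaced by `n`/`M`. [cite: FitznerVanDerHofstad2016NoBLE, §5.3.2 (first display) p. 1097] -/
theorem isRemKernelConst_srwK_univ_of_eq (c : List ℕ) {n M : ℕ} (hc : c.length = n) (hs : c.sum = M)
    (hn : 2 * n + 1 ≤ d) (hd : 2 ≤ d) :
    IsRemKernelConst d c Set.univ ((2 * (d : ℝ)) ^ M * srwK d n M 0) := by
  subst hc hs
  exact isRemKernelConst_srwK_univ c hn hd

/-- One tail at printed constants: `p^M Γ̄₂ⁿ (2d)^M K_{n,M}(0) ≤ ((2d/(2d−1))Γ₁)^M (((2d−2)/(2d−1))Γ₂)ⁿ K_{n,M}(0)`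
(`(2d−1)p ≤ Γ₁`, `nobleF2 d p ≤ Γ₂`; `two_d_mul_le_of_le`, `nobleSup2_le_of_nobleF2_le`, `K ≥ 0`).
[cite: FitznerVanDerHofstad2016NoBLE, §5.3.1 and (5.13) (PTRF 169 (2017) pp. 1091, 1096–1097)] -/
theorem srwK_tail_le_printed (hd : 2 ≤ d) (p : unitInterval) {Γ₁ Γ₂ : ℝ} (hΓ1 : (2 * d - 1) * (p : ℝ) ≤ Γ₁)
    (hΓ2 : nobleF2 d p ≤ Γ₂) (n M : ℕ) :
    (p : ℝ) ^ M * (nobleSup2 d p ^ n * ((2 * (d : ℝ)) ^ M * srwK d n M 0)) ≤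
      (2 * d / (2 * d - 1) * Γ₁) ^ M * (((2 * d - 2) / (2 * d - 1) * Γ₂) ^ n * srwK d n M 0) := by
  have hp0 : 0 ≤ (p : ℝ) := p.2.1
  have hG0 : 0 ≤ nobleSup2 d p := nobleSup2_nonneg' p
  have hΓ : nobleSup2 d p ≤ (2 * d - 2) / (2 * d - 1) * Γ₂ := nobleSup2_le_of_nobleF2_le hd p hΓ2
  have hdp : 2 * d * (p : ℝ) ≤ 2 * d / (2 * d - 1) * Γ₁ := two_d_mul_le_of_le (by omega) p hΓ1
  have hdp0 : 0 ≤ 2 * d * (p : ℝ) := by positivity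
  have hK : 0 ≤ srwK d n M 0 := srwK_nonneg n M 0
  calc (p : ℝ) ^ M * (nobleSup2 d p ^ n * ((2 * (d : ℝ)) ^ M * srwK d n M 0))
      = (2 * d * (p : ℝ)) ^ M * (nobleSup2 d p ^ n * srwK d n M 0) := by rw [mul_pow]; ring
    _ ≤ _ := mul_le_mul (pow_le_pow_left₀ hdp0 hdp M) (mul_le_mul_of_nonneg_right (pow_le_pow_left₀ hG0 hΓ n) hK)
        (mul_nonneg (pow_nonneg hG0 n) hK) (pow_nonneg (hdp0.trans hdp) M)

/-- **The closed repulsive triangle summed over finite sets is dominated by the Triangle cell**: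
`Σ_{v∈S₁} Σ_{y∈S₂} repTriangle d p m₁ m₂ m₃ v y 0 ≤ trianglePrintedR d p Γ₁ Γ₂ (m₁+m₂+m₃) M`
(`7 ≤ d`, `p < p_c`, `m₂ + m₃ ≤ M`, `(2d−1)p ≤ Γ₁`, `nobleF2 d p ≤ Γ₂`) — the landed slot theorem at `x = 0`, `X = univ`,
slots `(2d)^M K_{n,M}(0)` for `[M]`, `[M−m₃, m₃]`, `[M−m₂−m₃, m₂, m₃]`, then `srwK_tail_le_printed`.
[cite: FitznerVanDerHofstad2016NoBLE, §5.3.2 (5.41) p. 1098, first display p. 1097]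
[cite: FitznerVanDerHofstad2017, §4.2 (4.17)–(4.18) and the display after it (arXiv:1506.07977v2 p. 36)] -/
theorem sum_sum_repTriangle_zero_le_trianglePrintedR (hd : 7 ≤ d) (p : unitInterval) (hp : p < criticalProbI d)
    {m₁ m₂ m₃ M : ℕ} (hm : m₂ + m₃ ≤ M) {Γ₁ Γ₂ : ℝ} (hΓ1 : (2 * d - 1) * (p : ℝ) ≤ Γ₁)
    (hΓ2 : nobleF2 d p ≤ Γ₂) (S₁ S₂ : Finset (Site d)) :
    ∑ v ∈ S₁, ∑ y ∈ S₂, repTriangle d p m₁ m₂ m₃ v y 0 ≤ trianglePrintedR d p Γ₁ Γ₂ (m₁ + m₂ + m₃) M := by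
  have hR₁ := isRemKernelConst_srwK_univ_of_eq (d := d) [M] (n := 1) (M := M) rfl (by simp) (by omega) (by omega)
  have hR₂ := isRemKernelConst_srwK_univ_of_eq (d := d) [M - m₃, m₃] (n := 2) (M := M) rfl
    (by simp; omega) (by omega) (by omega)
  have hR₃ := isRemKernelConst_srwK_univ_of_eq (d := d) [M - (m₂ + m₃), m₂, m₃] (n := 3) (M := M) rfl
    (by simp; omega) (by omega) (by omega)
  refine (sum_sum_repTriangle_le_slots (by omega) p hp hm (Set.mem_univ _) hR₁ hR₂ hR₃ S₁ S₂).trans ?_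
  unfold trianglePrintedR
  refine add_le_add (add_le_add (add_le_add le_rfl ?_) ?_) ?_
  · refine mul_le_mul_of_nonneg_left ?_ (Nat.cast_nonneg _)
    simpa only [pow_one] using srwK_tail_le_printed (by omega) p hΓ1 hΓ2 1 M
  · exact mul_le_mul_of_nonneg_left (srwK_tail_le_printed (by omega) p hΓ1 hΓ2 2 M) (Nat.cast_nonneg _)
  · exact srwK_tail_le_printed (by omega) p hΓ1 hΓ2 3 M

/-- Under the cell's hypotheses `0 ≤ trianglePrintedR d p Γ₁ Γ₂ (m₁+m₂+m₃) M` (the case `S₁ = S₂ = ∅`).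
[cite: FitznerVanDerHofstad2016NoBLE, §5.3.2 (5.41) p. 1098] -/
theorem trianglePrintedR_nonneg (hd : 7 ≤ d) (p : unitInterval) (hp : p < criticalProbI d) {m₁ m₂ m₃ M : ℕ}
    (hm : m₂ + m₃ ≤ M) {Γ₁ Γ₂ : ℝ} (hΓ1 : (2 * d - 1) * (p : ℝ) ≤ Γ₁) (hΓ2 : nobleF2 d p ≤ Γ₂) :
    0 ≤ trianglePrintedR d p Γ₁ Γ₂ (m₁ + m₂ + m₃) M := by
  simpa using sum_sum_repTriangle_zero_le_trianglePrintedR hd p hp hm hΓ1 hΓ2 ∅ ∅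

/-! ## C. The instance's closed triangle letter summed over `ℤ^d × ℤ^d` -/

/-- **`Σ_v Σ_y 𝓣_{m₁,m₂,m₃}(v,y,0) ≤ Bound[Triangle, m₁+m₂+m₃, M]`** for the percolation letter table
(`perc_T_ge : 𝓣 = ofReal repTriangle`, finite rectangles, `tsum_tsum_le_of_finset_rect`).
[cite: FitznerVanDerHofstad2017, §4.2 (4.17)–(4.18) (arXiv:1506.07977v2 p. 36); §5.4 closing paragraph (p. 56)]
[cite: FitznerVanDerHofstad2016NoBLE, §5.3.2 (5.41) p. 1098] -/
theorem tsum_tsum_perc_T_zero_le_ofReal (hd : 7 ≤ d) (p : unitInterval) (hp : p < criticalProbI d)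
    {m₁ m₂ m₃ M : ℕ} (hm : m₂ + m₃ ≤ M) {Γ₁ Γ₂ : ℝ} (hΓ1 : (2 * d - 1) * (p : ℝ) ≤ Γ₁)
    (hΓ2 : nobleF2 d p ≤ Γ₂) :
    ∑' v, ∑' y, (Letters.perc d p).T (.ge m₁) (.ge m₂) (.ge m₃) v y 0 ≤
      ENNReal.ofReal (trianglePrintedR d p Γ₁ Γ₂ (m₁ + m₂ + m₃) M) := by
  refine tsum_tsum_le_of_finset_rect fun S₁ S₂ => ?_
  calc ∑ v ∈ S₁, ∑ y ∈ S₂, (Letters.perc d p).T (.ge m₁) (.ge m₂) (.ge m₃) v y 0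
      = ENNReal.ofReal (∑ v ∈ S₁, ∑ y ∈ S₂, repTriangle d p m₁ m₂ m₃ v y 0) := by
        rw [ENNReal.ofReal_sum_of_nonneg fun v _ => Finset.sum_nonneg fun y _ => repTriangle_nonneg p _ _ _ _ _ _]
        refine Finset.sum_congr rfl fun v _ => ?_
        rw [ENNReal.ofReal_sum_of_nonneg fun y _ => repTriangle_nonneg p _ _ _ _ _ _]
        exact Finset.sum_congr rfl fun y _ => perc_T_ge p _ _ _ _ _ _
    _ ≤ _ := ENNReal.ofReal_le_ofReal (sum_sum_repTriangle_zero_le_trianglePrintedR hd p hp hm hΓ1 hΓ2 S₁ S₂)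

/-- `Σ_x 𝓓_{n,n}(x) ≤ ofReal B` for the instance's letter from any `SumLE (diagD d p n n) B`
(`perc_D_ge : 𝓓 = diagDT`, `diagD = toReal ∘ diagDT`). [cite: FitznerVanDerHofstad2017, §4.2 (4.20)–(4.23) (arXiv:1506.07977v2 pp. 36–37)] -/
theorem tsum_perc_D_ge_le_of_sumLE (p : unitInterval) {n : ℕ} {B : ℝ} (hB : SumLE (diagD d p n n) B) :
    ∑' x, (Letters.perc d p).D (.ge n) (.ge n) x ≤ ENNReal.ofReal B := by
  obtain ⟨hs, hle⟩ := hB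
  calc ∑' x, (Letters.perc d p).D (.ge n) (.ge n) x = ∑' x, ENNReal.ofReal (diagD d p n n x) :=
        tsum_congr fun x => by rw [perc_D_ge, diagD, ENNReal.ofReal_toReal (diagDT_ne_top p n n x)]
    _ = ENNReal.ofReal (∑' x, diagD d p n n x) :=
        (ENNReal.ofReal_tsum_of_nonneg (fun x => diagD_nonneg p n n x) hs).symm
    _ ≤ ENNReal.ofReal B := ENNReal.ofReal_le_ofReal hle

/-! ## D. The entries `(P⃗^E)_2` and `(P⃗^S)_2` -/

/-- For any letter table: `(P⃗^E)_2 ≤ Σ_x Σ_y 𝓣_{1,2,1}(x,y,0)` (the factors `(1−δ_{x,0})(1−δ_{y,0}) ≤ 1` dropped).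
[cite: FitznerVanDerHofstad2017, App. B Table "definition of P^b(x,y)", row b = 2 (arXiv:1506.07977v2 p. 73); §5.1 "Elements of the bounds" (p. 49)] -/
theorem vecPE_two_le_tsum (L : Letters d) :
    vecPE L 2 ≤ ∑' x, ∑' y, L.T (.ge 1) (.ge 2) (.ge 1) x y 0 := by
  rw [vecPE_two]
  exact ENNReal.tsum_le_tsum fun x => ENNReal.tsum_le_tsum fun y =>
    (mul_le_mul' (mul_le_mul' (kdc_le_one x 0) (kdc_le_one y 0)) le_rfl).trans_eq (by rw [one_mul, one_mul])

/-- For any letter table: `(P⃗^S)_2 ≤ Σ_x 𝓓_{2,2}(x) + Σ_x Σ_y 𝓣_{1,2,1}(x,y,0)` (the factors `(1−δ)` dropped,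
`tsum_add`). [cite: FitznerVanDerHofstad2017, App. B Table "definition of P^b(x,y)", row b = 2 (arXiv:1506.07977v2 p. 73); §5.1 "Elements of the bounds" (p. 49)] -/
theorem vecPS_two_le_add (L : Letters d) :
    vecPS L 2 ≤ (∑' x, L.D (.ge 2) (.ge 2) x) + ∑' x, ∑' y, L.T (.ge 1) (.ge 2) (.ge 1) x y 0 := by
  rw [vecPS_two]
  calc ∑' x, kdc x 0 * (L.D (.ge 2) (.ge 2) x + ∑' y, kdc y 0 * L.T (.ge 1) (.ge 2) (.ge 1) x y 0)
      ≤ ∑' x, (L.D (.ge 2) (.ge 2) x + ∑' y, L.T (.ge 1) (.ge 2) (.ge 1) x y 0) :=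
        ENNReal.tsum_le_tsum fun x =>
          ((mul_le_mul' (kdc_le_one x 0) le_rfl).trans_eq (one_mul _)).trans
            (add_le_add le_rfl (ENNReal.tsum_le_tsum fun y =>
              (mul_le_mul' (kdc_le_one y 0) le_rfl).trans_eq (one_mul _)))
    _ = (∑' x, L.D (.ge 2) (.ge 2) x) + ∑' x, ∑' y, L.T (.ge 1) (.ge 2) (.ge 1) x y 0 := ENNReal.tsum_add

/-- The real majorant of the entry `(P⃗^E)_2`: `Bound[Triangle, 4, M]`.
[cite: FitznerVanDerHofstad2017, notebook Percolation.nb cell 16 (`Bound[PE,2,s] = Bound[Triangle,4,s]`); §5.1 (arXiv:1506.07977v2 p. 49)] -/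
def vecPETwoR (d : ℕ) (p Γ₁ Γ₂ : ℝ) (M : ℕ) : ℝ := trianglePrintedR d p Γ₁ Γ₂ 4 M

/-- **The entry inequality for `(P⃗^E)_2`: `vecPE (Letters.perc d p) 2 ≤ ofReal (Bound[Triangle, 4, M])`**
(`7 ≤ d`, `p < p_c`, `(2d−1)p ≤ Γ₁`, `nobleF2 d p ≤ Γ₂`, `3 ≤ M`).
[cite: FitznerVanDerHofstad2017, §5.1 "Elements of the bounds" (arXiv:1506.07977v2 p. 49), §5.4 closing paragraph (p. 56), §4.2 (4.17)–(4.18) (p. 36); notebook Percolation.nb cells 11, 16]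
[cite: FitznerVanDerHofstad2016NoBLE, §5.3.2 (5.41) p. 1098] -/
theorem vecPE_two_le_ofReal (hd : 7 ≤ d) (p : unitInterval) (hp : p < criticalProbI d) {Γ₁ Γ₂ : ℝ}
    (hΓ1 : (2 * d - 1) * (p : ℝ) ≤ Γ₁) (hΓ2 : nobleF2 d p ≤ Γ₂) {M : ℕ} (hM : 3 ≤ M) :
    vecPE (Letters.perc d p) 2 ≤ ENNReal.ofReal (vecPETwoR d p Γ₁ Γ₂ M) :=
  (vecPE_two_le_tsum _).trans
    (tsum_tsum_perc_T_zero_le_ofReal hd p hp (m₁ := 1) (m₂ := 2) (m₃ := 1) (by omega) hΓ1 hΓ2)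

/-- Under the hypotheses of `vecPE_two_le_ofReal` the majorant is non-negative (the consumer's `hw0`).
[cite: FitznerVanDerHofstad2017, §5.1 "Elements of the bounds" (arXiv:1506.07977v2 p. 49)] -/
theorem vecPETwoR_nonneg (hd : 7 ≤ d) (p : unitInterval) (hp : p < criticalProbI d) {Γ₁ Γ₂ : ℝ}
    (hΓ1 : (2 * d - 1) * (p : ℝ) ≤ Γ₁) (hΓ2 : nobleF2 d p ≤ Γ₂) {M : ℕ} (hM : 3 ≤ M) :
    0 ≤ vecPETwoR d p Γ₁ Γ₂ M :=
  trianglePrintedR_nonneg hd p hp (m₁ := 1) (m₂ := 2) (m₃ := 1) (by omega) hΓ1 hΓ2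

/-- The real majorant of the entry `(P⃗^S)_2` in the notebook's composition: `½·Bound[Bubble, 2, M] + Bound[Triangle, 4, M]`.
[cite: FitznerVanDerHofstad2017, notebook Percolation.nb cell 16 (`Bound[PS,2,s] = Bound[Triangle,4,s] + ½ Bound[Bubble,2,s]`); §5.1 (arXiv:1506.07977v2 p. 49)] -/
def vecPSTwoR (d : ℕ) (p Γ₁ Γ₂ : ℝ) (M : ℕ) : ℝ :=
  halfBubblePrintedR d p Γ₁ Γ₂ 1 M + trianglePrintedR d p Γ₁ Γ₂ 4 M

/-- **The entry inequality for `(P⃗^S)_2`: `vecPS (Letters.perc d p) 2 ≤ ofReal (½·Bound[Bubble, 2, M] + Bound[Triangle, 4, M])`**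
(`7 ≤ d`, `p < p_c`, `(2d−1)p ≤ Γ₁`, `nobleF2 d p ≤ Γ₂`, `3 ≤ M`): `𝓓_{2,2} ≤ 𝓓_{1,1}` pointwise ((4.12), `diagDT_anti`),
the Bubble cell at `n = 1` (`sumLE_diagD_halfBubblePrintedR`) and the Triangle cell.
[cite: FitznerVanDerHofstad2017, §5.1 "Elements of the bounds" (arXiv:1506.07977v2 p. 49), §5.4 closing paragraph (p. 56), §4.2 (4.12), (4.17)–(4.21) (pp. 35–37); notebook Percolation.nb cells 11, 16]
[cite: FitznerVanDerHofstad2016NoBLE, §5.3.2 (5.41) p. 1098] -/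
theorem vecPS_two_le_ofReal (hd : 7 ≤ d) (p : unitInterval) (hp : p < criticalProbI d) {Γ₁ Γ₂ : ℝ}
    (hΓ1 : (2 * d - 1) * (p : ℝ) ≤ Γ₁) (hΓ2 : nobleF2 d p ≤ Γ₂) {M : ℕ} (hM : 3 ≤ M) :
    vecPS (Letters.perc d p) 2 ≤ ENNReal.ofReal (vecPSTwoR d p Γ₁ Γ₂ M) := by
  have hB := halfBubblePrintedR_nonneg (by omega) p hp (n := 1) le_rfl (M := M) (by omega) hΓ1 hΓ2
  have hT := trianglePrintedR_nonneg hd p hp (m₁ := 1) (m₂ := 2) (m₃ := 1) (M := M) (by omega) hΓ1 hΓ2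
  rw [vecPSTwoR, ENNReal.ofReal_add hB hT]
  refine (vecPS_two_le_add _).trans (add_le_add ?_
    (tsum_tsum_perc_T_zero_le_ofReal hd p hp (m₁ := 1) (m₂ := 2) (m₃ := 1) (by omega) hΓ1 hΓ2))
  calc ∑' x, (Letters.perc d p).D (.ge 2) (.ge 2) x ≤ ∑' x, (Letters.perc d p).D (.ge 1) (.ge 1) x :=
        ENNReal.tsum_le_tsum fun x => diagDT_anti p (by norm_num) (by norm_num) x
    _ ≤ _ := tsum_perc_D_ge_le_of_sumLE p (sumLE_diagD_halfBubblePrintedR (by omega) p hp (n := 1) le_rfl (by omega) hΓ1 hΓ2)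

/-- Under the hypotheses of `vecPS_two_le_ofReal` the majorant is non-negative (the consumer's `hu0`).
[cite: FitznerVanDerHofstad2017, §5.1 "Elements of the bounds" (arXiv:1506.07977v2 p. 49)] -/
theorem vecPSTwoR_nonneg (hd : 7 ≤ d) (p : unitInterval) (hp : p < criticalProbI d) {Γ₁ Γ₂ : ℝ}
    (hΓ1 : (2 * d - 1) * (p : ℝ) ≤ Γ₁) (hΓ2 : nobleF2 d p ≤ Γ₂) {M : ℕ} (hM : 3 ≤ M) :
    0 ≤ vecPSTwoR d p Γ₁ Γ₂ M :=
  add_nonneg (halfBubblePrintedR_nonneg (by omega) p hp (n := 1) le_rfl (by omega) hΓ1 hΓ2)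
    (trianglePrintedR_nonneg hd p hp (m₁ := 1) (m₂ := 2) (m₃ := 1) (by omega) hΓ1 hΓ2)

/-- **The sharper variant through the Bubble cell at `n = 2`**:
`vecPS (Letters.perc d p) 2 ≤ ofReal (½·Bound[Bubble, 4, M] + Bound[Triangle, 4, M])` (`4 ≤ M`).
[cite: FitznerVanDerHofstad2017, §5.1 (arXiv:1506.07977v2 p. 49), §4.2 (4.17)–(4.23) (pp. 36–37)]
[cite: FitznerVanDerHofstad2016NoBLE, §5.3.2 (5.41) p. 1098] -/
theorem vecPS_two_le_ofReal_sharp (hd : 7 ≤ d) (p : unitInterval) (hp : p < criticalProbI d) {Γ₁ Γ₂ : ℝ}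
    (hΓ1 : (2 * d - 1) * (p : ℝ) ≤ Γ₁) (hΓ2 : nobleF2 d p ≤ Γ₂) {M : ℕ} (hM : 4 ≤ M) :
    vecPS (Letters.perc d p) 2 ≤
      ENNReal.ofReal (halfBubblePrintedR d p Γ₁ Γ₂ 2 M + trianglePrintedR d p Γ₁ Γ₂ 4 M) := by
  have hB := halfBubblePrintedR_nonneg (by omega) p hp (n := 2) (by norm_num) (M := M) (by omega) hΓ1 hΓ2
  have hT := trianglePrintedR_nonneg hd p hp (m₁ := 1) (m₂ := 2) (m₃ := 1) (M := M) (by omega) hΓ1 hΓ2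
  rw [ENNReal.ofReal_add hB hT]
  exact (vecPS_two_le_add _).trans (add_le_add
    (tsum_perc_D_ge_le_of_sumLE p (sumLE_diagD_halfBubblePrintedR (by omega) p hp (n := 2) (by norm_num) (by omega) hΓ1 hΓ2))
    (tsum_tsum_perc_T_zero_le_ofReal hd p hp (m₁ := 1) (m₂ := 2) (m₃ := 1) (by omega) hΓ1 hΓ2))

/-! ## E. The matrix entry `(A)_{0,2}` (the same closed repulsive triangle) -/

/-- For any letter table: `(A)_{0,2} ≤ Σ_x Σ_y 𝓣_{1,2,1}(x,y,0)` (the factors `(1−δ_{y,0})(1−δ_{x,0}) ≤ 1` dropped).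
[cite: FitznerVanDerHofstad2017, App. B Table "definition of A^{a,b}(0,v,x,y)", row (0,2) (arXiv:1506.07977v2 p. 74); §5.1 "Elements of the bounds" (p. 49)] -/
theorem matA_zero_two_le_tsum (L : Letters d) :
    matA L 0 2 ≤ ∑' x, ∑' y, L.T (.ge 1) (.ge 2) (.ge 1) x y 0 := by
  rw [matA_zero_two]
  exact ENNReal.tsum_le_tsum fun x => ENNReal.tsum_le_tsum fun y =>
    (mul_le_mul' (mul_le_mul' (kdc_le_one y 0) (kdc_le_one x 0)) le_rfl).trans_eq (by rw [one_mul, one_mul])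

/-- **The entry inequality for `(A)_{0,2}`: `matA (Letters.perc d p) 0 2 ≤ ofReal (Bound[Triangle, 4, M])`**
(`7 ≤ d`, `p < p_c`, `(2d−1)p ≤ Γ₁`, `nobleF2 d p ≤ Γ₂`, `3 ≤ M`; notebook cell 18 `Bound[A,0,2,s] = Bound[Triangle,4,s]`,
typed as `Stage1Cells.A P 0 2`).
[cite: FitznerVanDerHofstad2017, §5.1 "Elements of the bounds" (arXiv:1506.07977v2 p. 49), App. B Table "definition of A^{a,b}(0,v,x,y)" row (0,2) (p. 74), §4.2 (4.17)–(4.18) (p. 36); notebook Percolation.nb cells 11, 18]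
[cite: FitznerVanDerHofstad2016NoBLE, §5.3.2 (5.41) p. 1098] -/
theorem perc_matA_zero_two_le_ofReal (hd : 7 ≤ d) (p : unitInterval) (hp : p < criticalProbI d) {Γ₁ Γ₂ : ℝ}
    (hΓ1 : (2 * d - 1) * (p : ℝ) ≤ Γ₁) (hΓ2 : nobleF2 d p ≤ Γ₂) {M : ℕ} (hM : 3 ≤ M) :
    matA (Letters.perc d p) 0 2 ≤ ENNReal.ofReal (trianglePrintedR d p Γ₁ Γ₂ 4 M) :=
  (matA_zero_two_le_tsum _).trans
    (tsum_tsum_perc_T_zero_le_ofReal hd p hp (m₁ := 1) (m₂ := 2) (m₃ := 1) (by omega) hΓ1 hΓ2)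

end Literature.Probability.FitznerVanDerHofstad2017

end
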